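import Summits.CriticalPhenomena.CardyFormulaZ2.Theses.CardySegmentWeakRSW
import Summits.CriticalPhenomena.CardyFormulaZ2.Theses.CardySelfDualSegment
import Summits.CriticalPhenomena.CardyFormulaZ2.Theorems.CardySelfDualSegmentSegmentOpenIffTarget

/-!
# Birth-vetting census for crux `SegmentOpen` (stmt-CriticalPhenomena-5471) inside route
`CardySegmentWeakRSW` (refuter crux-attack, 2026-08-17)

* `segmentOpen_iff_parent`, `uniformMarginality_iff_parent` : the new route's decls are the parent
  route's decls VERBATIM (`Iff.rfl`), so every landed census / negative lemma on
  `CardySelfDualSegment.SegmentOpen` (Theorems/SegmentOpen/Negative/*, `…SegmentOpenIffTarget`)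
  applies unchanged.
* `target_of_segmentOpen'` : inside the NEW route, the rung `ClosedOfWeakBoxCrossing` fed by
  `WeakBoxCrossing` and `UniformMarginality`, together with `SegmentOpen`, already gives the parent's
  `Target` (linear universality along the whole segment, `G = univ`) — the same clopen sweep as the
  deciding theorem `closes`, read at every `t` instead of `t = 1`.
* `segmentOpen_iff_target'`, `segmentOpen_iff_um_imp_target'`, `not_segmentOpen_iff'` : hence,
  modulo the two sibling cruxes of THIS route (18421 rung, 18422 WBC), the crux is literally
  `UniformMarginality → Target`, and `¬ SegmentOpen ↔ (UniformMarginality ∧ ¬ Target)`: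
  a refutation needs BOTH uniform marginality (crux 5472, XL) AND a failure of linear universality
  at some `t ∈ [0,1]` — neither is within reach of a cheap attack (restates-summit record: the crux
  with its siblings proves `Target`, which is STRONGER than the summit `CardyFormulaZ2` = the `t = 1`
  instance read through `quarterTurnPinning_proof` + `crudeToCanonical_proof`).
-/

namespace Summit.CriticalPhenomena.CardyFormulaZ2.Cruxes.SegmentOpen.BirthVetWeakRSW

open Summit.CriticalPhenomena.CardyFormulaZ2.Theses
open Summit.CriticalPhenomena.CardyFormulaZ2.Theses.CardySegmentWeakRSW
open Summit.CriticalPhenomena.CardyFormulaZ2.Theorems (segmentOpen_of_target smirnovBasePoint_proof)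

/-- The new route's `SegmentOpen` is the parent route's `SegmentOpen`, by `Iff.rfl`. -/
theorem segmentOpen_iff_parent : SegmentOpen ↔ CardySelfDualSegment.SegmentOpen := Iff.rfl

/-- The new route's `UniformMarginality` is the parent route's, by `Iff.rfl`. -/
theorem uniformMarginality_iff_parent :
    UniformMarginality ↔ CardySelfDualSegment.UniformMarginality := Iff.rfl

/-- Inside route `CardySegmentWeakRSW`: rung + WBC + UM + SegmentOpen ⇒ the parent's `Target`
(`G = univ`), by the clopen sweep on the preconnected `unitInterval` with base point
`smirnovBasePoint_proof`. -/
theorem target_of_segmentOpen' (hC : ClosedOfWeakBoxCrossing) (hW : WeakBoxCrossing)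
    (hM : UniformMarginality) (hO : SegmentOpen) : CardySelfDualSegment.Target := by
  intro t
  have hGo := hO hM
  have hGc := hC hW hM
  have hclopen : IsClopen _ := ⟨hGc, hGo⟩
  have hz : 0 < Literature.Probability.LatticeModels.triZeta.im := by
    unfold Literature.Probability.LatticeModels.triZeta
    rw [Complex.exp_im]
    have hre : ((Real.pi : ℂ) * Complex.I / 3).re = 0 := by simp
    have him : ((Real.pi : ℂ) * Complex.I / 3).im = Real.pi / 3 := by simp
    rw [hre, him, Real.exp_zero, one_mul]
    exact Real.sin_pos_of_pos_of_lt_pi (by positivity) (by linarith [Real.pi_pos])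
  haveI : PreconnectedSpace unitInterval := Subtype.preconnectedSpace isPreconnected_Icc
  have huniv := hclopen.eq_univ ⟨0, Literature.Probability.LatticeModels.triZeta, hz,
    smirnovBasePoint_proof⟩
  exact (Set.eq_univ_iff_forall.mp huniv) t

/-- Census: modulo the rung, WBC and UM, `SegmentOpen ↔ Target`. -/
theorem segmentOpen_iff_target' (hC : ClosedOfWeakBoxCrossing) (hW : WeakBoxCrossing)
    (hM : UniformMarginality) : SegmentOpen ↔ CardySelfDualSegment.Target :=
  ⟨target_of_segmentOpen' hC hW hM, fun hT => segmentOpen_of_target hT⟩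

/-- Census: modulo the rung and WBC alone, `SegmentOpen ↔ (UniformMarginality → Target)`. -/
theorem segmentOpen_iff_um_imp_target' (hC : ClosedOfWeakBoxCrossing) (hW : WeakBoxCrossing) :
    SegmentOpen ↔ (UniformMarginality → CardySelfDualSegment.Target) :=
  ⟨fun hO hM => target_of_segmentOpen' hC hW hM hO, fun h hM => segmentOpen_of_target (h hM) hM⟩

/-- What a refutation of the crux would be inside this route (rung and WBC as hypotheses):
`¬ SegmentOpen ↔ (UniformMarginality ∧ ¬ Target)`. -/
theorem not_segmentOpen_iff' (hC : ClosedOfWeakBoxCrossing) (hW : WeakBoxCrossing) :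
    ¬ SegmentOpen ↔ (UniformMarginality ∧ ¬ CardySelfDualSegment.Target) := by
  rw [segmentOpen_iff_um_imp_target' hC hW, Classical.not_imp]

/-- `Target → SegmentOpen` unconditionally (so `G = univ` trivialises the crux; the only other
trivialisation is `¬ UniformMarginality`). -/
theorem segmentOpen_of_target' (hT : CardySelfDualSegment.Target) : SegmentOpen :=
  segmentOpen_of_target hT

/-- `¬ UniformMarginality → SegmentOpen` (vacuous-hypothesis trivialisation). -/
theorem segmentOpen_of_not_um (h : ¬ UniformMarginality) : SegmentOpen := fun hM => absurd hM h

end Summit.CriticalPhenomena.CardyFormulaZ2.Cruxes.SegmentOpen.BirthVetWeakRSW
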